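/-
Copyright (c) 2026 the pub-hodgecm-mathlib formalisation cell (harness21).  Prover seat hodgecm-mathlib-A-p06 (g36), L2 organ (IMG) «IMAGE LINE ENGINE», piece (t1) «the
composite `V(J″^sat) → G → 𝒜_x̃″ → 𝒞_x̃″` is a CLOSED IMMERSION» (LA2-plan (g2) ruling 2026-09-02T08:56:42Z: «finite + mono; Mathlib name on report»); 2026-09-02.
-/
import Literature.AlgebraicGeometry.GroupSchemes.IdealKernelLayerMapThroughCover   -- ★ `comp_eq_self_of_add_eq_one` (the scalar fact), `mono_pin_comp_cover` (full-pin version)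
import Mathlib.AlgebraicGeometry.Morphisms.Finite                                 -- Mathlib `IsClosedImmersion.iff_isFinite_and_mono`
import HarnessLib

/-!
# A sub-pin through a cover is a closed immersion: `ζ ≫ ψ_P` is a monomorphism when a return map of `ψ_P` fixes `ζ`, and finite monomorphisms of schemes
# are closed immersions ([Tate 1997] (1.6)–(1.7); [Conrad 2004] §7 Thm. 7.5; [Görtz–Wedhorn I] Cor. 12.92 ∕ Mathlib `IsClosedImmersion.iff_isFinite_and_mono`)

Topic `Literature/AlgebraicGeometry/GroupSchemes`; namespace `Literature.AlgebraicGeometry.GroupSchemes.IdealKernelLayerMap` (continues ★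
`IdealKernelLayerMapThroughCover`).  THEOREMS ONLY (no definition, no named fact, no `instance`, no notation, no `sorry`).  Cell `hodgecm-mathlib` (D-0151), FLOOR 0,
P6 «MOD programme» (crux hLiu418 = stmt-HodgeConjecture-24832, `--supports`, count-neutral): line L2, organ (IMG) «IMAGE LINE ENGINE», piece (t1).  The (IMG) row of
the (ρ1𝒞) road (★ `RoofLegsSpecialFibreKernelRowsImage`, row (IMG-gen)) transports a FACTORISATION of the reduced leg through a model subscheme `ζ : 𝒵 → 𝒜_x̃″` whose
composite with the model cover leg `c̄_R = ψ_P ×_𝓨 x̃″ : 𝒜_x̃″ → 𝒞_x̃″` is a CLOSED IMMERSION; the caller's `ζ` is a SUB-PIN `V(J″^sat) ↪ G ↪ 𝒜_x̃″` (a closed subgroup of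
the dock's torsion model `G`, killed by an ideal `𝔡` prime to the cover's kernel ideal).  This file discharges that side condition once and generically, and names the
Mathlib fact it rests on: **a morphism of schemes is a closed immersion iff it is finite and a monomorphism** (`AlgebraicGeometry.IsClosedImmersion.iff_isFinite_and_mono`,
[GortzWedhorn2020] Cor. 12.92 ∕ Prop. 12.94).  HC_CM is proved only modulo the printed citations (2 remaining named inputs hLiu418 24832, h413 24833) until rung 0 closes;
this file is generic and changes no count.

THE MATHEMATICS.  (§1, any category) If `ζ : Z → A″` is a monomorphism and some endomorphism `r : A″ → A″` through which `ψ_P : A″ → Cc` returns (`ψ_P ≫ g = r`)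
FIXES `ζ` (`ζ ≫ r = ζ`), then `ζ ≫ ψ_P` is a monomorphism: `u ≫ ζ ≫ ψ_P = v ≫ ζ ≫ ψ_P ⇒ (≫ g) u ≫ ζ ≫ r = v ≫ ζ ≫ r ⇒ u ≫ ζ = v ≫ ζ ⇒ u = v`.  In a cartesian
monoidal category with an additive unital family `α″ : 𝒪 → End A″` ([Tate1997FiniteFlatGroupSchemes] (1.6)–(1.7): group functors), the SCALAR FACT ★
`comp_eq_self_of_add_eq_one` supplies the fixing: if `ζ` is killed by `𝔡` (`ζ ≫ α″ x = 1` for `x ∈ 𝔡`) and `a + b = 1` with `b ∈ 𝔡`, then `ζ ≫ α″ a = ζ`; so a return map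
`g` with `ψ_P ≫ g = α″ a` ([Conrad2004GrossZagier] §7 Thm. 7.5: the Serre cover `ψ_P : A → A ⊗ 𝔞⁻¹` has `ψ_P ∘ g_a = a` for `a ∈ 𝔞`; with `𝔞 + 𝔡 = (1)` pick
`a ∈ 𝔞`, `b ∈ 𝔡`, `a + b = 1`) makes `ζ ≫ ψ_P` mono — the SUB-PIN version of ★ `mono_pin_comp_cover` (which asks the full kernel-of-`𝔡` universal property of the
pin; here only «killed by `𝔡`» is used, so closed subgroups `V(J) ↪ G ↪ A″` of a `𝔡`-torsion pin qualify).  (§2, schemes over a base `S`, objects of `Over S`) A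
monomorphism of `Over S` has mono underlying morphism (Mathlib `Over.mono_left_of_mono`); a closed immersion is finite and mono, finite morphisms compose; hence
**`ζ ≫ ψ_P` is a closed immersion as soon as `ζ` is a closed immersion, `ψ_P` is finite, and a return map of `ψ_P` fixes `ζ`** — by Mathlib
`IsClosedImmersion.iff_isFinite_and_mono` ([GortzWedhorn2020] Cor. 12.92: closed immersion ⟺ proper monomorphism ⟺ finite monomorphism, Prop. 12.94).

* §1 `mono_comp_of_comp_retract_eq_self` (any category: `ζ` mono, `ψ ≫ g = r`, `ζ ≫ r = ζ` ⇒ `Mono (ζ ≫ ψ)`), **`mono_subpin_comp_cover`** (cartesian monoidal: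
  `ζ` mono killed by `𝔡`, `ψ_P ≫ g = α″ a`, `a + b = 1`, `b ∈ 𝔡` ⇒ `Mono (ζ ≫ ψ_P)`).
* §2 `isClosedImmersion_left_of_isFinite_of_mono` (`Over S`: `Mono f`, `IsFinite f.left` ⇒ `IsClosedImmersion f.left`), `isClosedImmersion_comp_left_of_comp_retract_eq_self`,
  **`isClosedImmersion_subpin_comp_cover_left`** (the (t1) letter: `ζ` a closed immersion killed by `𝔡`, `ψ_P` finite with a return map `g`, `ψ_P ≫ g = α″ a`, `a + b = 1`,
  `b ∈ 𝔡` ⇒ `(ζ ≫ ψ_P).left` is a closed immersion).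

## References
* [Tate1997FiniteFlatGroupSchemes] J. Tate, *Finite flat group schemes*, in: Modular Forms and Fermat՚s Last Theorem (1997), (1.6)–(1.7) p. 122.
* [Conrad2004GrossZagier] B. Conrad, *Gross–Zagier revisited*, MSRI Publ. 49 (2004), §7 (Thm. 7.5).
* [GortzWedhorn2020] U. Görtz, T. Wedhorn, *Algebraic Geometry I*, 2nd ed. (2020), Cor. 12.92 and Prop. 12.94 (closed immersions = proper ∕ finite monomorphisms).
-/

set_option autoImplicit false

universe u

open CategoryTheory CategoryTheory.Limits MonoidalCategory CartesianMonoidalCategory AlgebraicGeometry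

noncomputable section

namespace Literature.AlgebraicGeometry.GroupSchemes.IdealKernelLayerMap

open scoped MonObj

/-! ## §1 A sub-pin through a cover is a monomorphism (any category ∕ any cartesian monoidal category) -/

section Generic

/-- **A monomorphism followed by a map with a return map fixing it is a monomorphism**: if `ζ : Z → A″` is mono, `ψ ≫ g = r` and `ζ ≫ r = ζ`, then `ζ ≫ ψ` is mono
(`u ≫ ζ ≫ ψ = v ≫ ζ ≫ ψ`, compose with `g`, cancel `ζ`). [cite: Conrad2004GrossZagier, §7 (Thm. 7.5)] -/
theorem mono_comp_of_comp_retract_eq_self {C : Type*} [Category C] {Z A'' Cc : C} (ζ : Z ⟶ A'') [Mono ζ] (ψ : A'' ⟶ Cc) (g : Cc ⟶ A'') (r : A'' ⟶ A'')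
    (hψg : ψ ≫ g = r) (hfix : ζ ≫ r = ζ) : Mono (ζ ≫ ψ) where
  right_cancellation u v h := by
    have h' := congrArg (· ≫ g) h
    simp only [Category.assoc, hψg, hfix] at h'
    exact (cancel_mono ζ).mp h'

variable {C : Type*} [Category C] [CartesianMonoidalCategory C]
variable {O : Type*} [CommRing O] {σ : Type*} [SetLike σ O]

/-- **(M′) A SUB-PIN THROUGH A COVER IS A MONOMORPHISM.**  `A″` a monoid object with an additive unital family `α″ : 𝒪 → End A″`; `ζ : Z ↪ A″` a monomorphism KILLED
BY `𝔡` (`ζ ≫ α″ x = 1` for all `x ∈ 𝔡`; e.g. a closed subgroup `V(J) ↪ G ↪ A″` of a `𝔡`-torsion pin); `ψ_P : A″ → Cc` with a return map `g`, `ψ_P ≫ g = α″ a`,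
`a + b = 1`, `b ∈ 𝔡`.  Then `ζ ≫ ψ_P` is a monomorphism: the scalar fact ★ `comp_eq_self_of_add_eq_one` gives `ζ ≫ α″ a = ζ`.  (The full-pin version, with the
kernel-of-`𝔡` universal property, is ★ `mono_pin_comp_cover`.) [cite: Tate1997FiniteFlatGroupSchemes, (1.6)–(1.7) p. 122] [cite: Conrad2004GrossZagier, §7 (Thm. 7.5)] -/
theorem mono_subpin_comp_cover {Cc A'' Z : C} [MonObj A''] (𝔡 : σ) (α'' : O → (A'' ⟶ A''))
    (h''add : ∀ x y, α'' (x + y) = α'' x * α'' y) (h''one : α'' 1 = 𝟙 A'')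
    (ζ : Z ⟶ A'') [Mono ζ] (hζ : ∀ x ∈ 𝔡, ζ ≫ α'' x = 1)
    (ψP : A'' ⟶ Cc) (g : Cc ⟶ A'') {a b : O} (hab : a + b = 1) (hb : b ∈ 𝔡) (hPg : ψP ≫ g = α'' a) :
    Mono (ζ ≫ ψP) :=
  mono_comp_of_comp_retract_eq_self ζ ψP g (α'' a) hPg (comp_eq_self_of_add_eq_one 𝔡 α'' h''add h''one hab hb hζ)

end Generic

/-! ## §2 Over a base scheme: finite monomorphisms are closed immersions (Mathlib `IsClosedImmersion.iff_isFinite_and_mono`) -/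

section Scheme

variable {S : Scheme.{u}}

/-- **A finite monomorphism of `S`-schemes is a closed immersion** — the packaging of Mathlib `AlgebraicGeometry.IsClosedImmersion.iff_isFinite_and_mono` for a morphism
`f` of `Over S` (`Mono f` in `Over S` gives `Mono f.left`, Mathlib `Over.mono_left_of_mono`). [cite: GortzWedhorn2020, Cor. 12.92 and Prop. 12.94] -/
theorem isClosedImmersion_left_of_isFinite_of_mono {Z W : Over S} (f : Z ⟶ W) [Mono f] [IsFinite f.left] : IsClosedImmersion f.left :=
  (IsClosedImmersion.iff_isFinite_and_mono f.left).mpr ⟨inferInstance, inferInstance⟩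

/-- **A closed immersion followed by a finite map with a return map fixing it is a closed immersion**: `ζ.left` a closed immersion, `ψ.left` finite, `ψ ≫ g = r`,
`ζ ≫ r = ζ` ⇒ `(ζ ≫ ψ).left` is a closed immersion (finite: composite of finite morphisms; mono: §1). [cite: GortzWedhorn2020, Cor. 12.92 and Prop. 12.94]
[cite: Conrad2004GrossZagier, §7 (Thm. 7.5)] -/
theorem isClosedImmersion_comp_left_of_comp_retract_eq_self {Z A'' Cc : Over S} (ζ : Z ⟶ A'') [IsClosedImmersion ζ.left] (ψ : A'' ⟶ Cc) [IsFinite ψ.left]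
    (g : Cc ⟶ A'') (r : A'' ⟶ A'') (hψg : ψ ≫ g = r) (hfix : ζ ≫ r = ζ) : IsClosedImmersion (ζ ≫ ψ).left := by
  haveI : Mono ζ := Over.mono_of_mono_left ζ
  haveI : Mono (ζ ≫ ψ) := mono_comp_of_comp_retract_eq_self ζ ψ g r hψg hfix
  haveI : IsFinite (ζ ≫ ψ).left := by rw [Over.comp_left]; infer_instance
  exact isClosedImmersion_left_of_isFinite_of_mono (ζ ≫ ψ)

/-- **(t1) A SUB-PIN THROUGH A FINITE COVER IS A CLOSED IMMERSION.**  Over a base scheme `S`: `A″` a monoid object of `Over S` with an additive unital family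
`α″ : 𝒪 → End A″`; `ζ : Z → A″` with `ζ.left` a CLOSED IMMERSION, killed by `𝔡` (`ζ ≫ α″ x = 1`, `x ∈ 𝔡`); `ψ_P : A″ → Cc` with `ψ_P.left` FINITE and a return map
`g`, `ψ_P ≫ g = α″ a`, `a + b = 1`, `b ∈ 𝔡`.  Then `(ζ ≫ ψ_P).left` is a closed immersion (finite + mono, Mathlib `IsClosedImmersion.iff_isFinite_and_mono`).  In the
(IMG) application: `S = Spec R`, `A″ = 𝒜_x̃″` with `α″ = ι`, `ζ = V(J″^sat) ↪ G ↪ 𝒜_x̃″` (`G` the `𝔡`-torsion dock model), `ψ_P = c̄_R` the model Serre cover leg of kernel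
ideal `𝔞` with `𝔞 + 𝔡 = (1)`, `g` its return map. [cite: GortzWedhorn2020, Cor. 12.92 and Prop. 12.94] [cite: Conrad2004GrossZagier, §7 (Thm. 7.5)]
[cite: Tate1997FiniteFlatGroupSchemes, (1.6)–(1.7) p. 122] -/
theorem isClosedImmersion_subpin_comp_cover_left {Cc A'' Z : Over S} [MonObj A''] {O : Type*} [CommRing O] {σ : Type*} [SetLike σ O]
    (𝔡 : σ) (α'' : O → (A'' ⟶ A'')) (h''add : ∀ x y, α'' (x + y) = α'' x * α'' y) (h''one : α'' 1 = 𝟙 A'')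
    (ζ : Z ⟶ A'') [IsClosedImmersion ζ.left] (hζ : ∀ x ∈ 𝔡, ζ ≫ α'' x = 1)
    (ψP : A'' ⟶ Cc) [IsFinite ψP.left] (g : Cc ⟶ A'') {a b : O} (hab : a + b = 1) (hb : b ∈ 𝔡) (hPg : ψP ≫ g = α'' a) :
    IsClosedImmersion (ζ ≫ ψP).left :=
  isClosedImmersion_comp_left_of_comp_retract_eq_self ζ ψP g (α'' a) hPg (comp_eq_self_of_add_eq_one 𝔡 α'' h''add h''one hab hb hζ)

end Scheme

end Literature.AlgebraicGeometry.GroupSchemes.IdealKernelLayerMap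

end
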